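import Summits.QuantumFields.BalabanUV.T4Continuum.Spine.NE1p.DressedTransportAssembledData
import Summits.QuantumFields.BalabanUV.T4Continuum.Spine.NE1p.DressedTransportAssembledRatio

/-!
# T⁴ programme, spine estimate NE1′ (node O3b/H2) — THE INSTANTIATION-FACING FORM OF THE ASSEMBLED TRANSPORT LEAF: ratio link AND
# canonical size ∕ radius ∕ budget data at once (swarm row S2 of `t4/formal/NE1p/LEAVES.md`, supplier item S2d = S2c ∘ S2b)

Cell `pub-balaban`, sub-cell `t4`, BINDER-OWNERS row NE1′, NE1′ FORMALISATION SWARM `b2b-balaban-t4-ne1p-formalise-*`, leaf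
prover 01 (unit `b2b-balaban-t4-ne1p-formalise-leaf-01`); owner lineage t4-ne1p-p1; tree target
`Summits/QuantumFields/BalabanUV/T4Continuum/Spine/NE1p/`; ADDITIVE — imports `Spine/NE1p/DressedTransportAssembledData` (S2b:
`rsOf`/`aszOf`/`s1Of` and their equations) and `Spine/NE1p/DressedTransportAssembledRatio` (S2c: `transportLeaf_assembled_ratio`)
ONLY; modifies nothing.

WHAT.  One theorem, **`transportLeaf_assembled_canonical_ratio`**: `DressedTransportAssembledRatio.transportLeaf_assembled_ratio`
(END-F′-RATIO, p213019) with `rs := rsOf r ϱ`, `Asz := aszOf T.gen s c Sg δf (rsOf r ϱ)`, `s1 := s1Of T.gen s c Sg δf (rsOf r ϱ)`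
— so that NONE of the Assembly's bookkeeping equalities (`hs1`, `hAsz_birth`, `hAsz_step`, `hrs_birth`, `hrs_step`), NO radius
floor and NO source-vs-floor scalar remain.  Displayed binders = the wall items of END-F ((w1) `hsl`; H2 `hFn`/`h𝒢` and the
dictionary `hQ`/`hSg`; (w2-act) `hB`/`hE`; (w3)⁺ `hN1`/`hN2`/`hdiam`/`hθ`/`hN1x`/`hN2cx`/`hmargin` (over `rsOf`), the schedule
inequalities `hϱ_birth`/`hϱ_succ`; (w4) `hdom`; (I4′) `hrate`/`hdefw`/`hpairx`/`hδfw` and THE LINK `hlink` (over `rsOf`); F-8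
`hlin`; F-9 positivity incl. `0 ≤ m`; measurability `hmeas`; invariance `hinv`).  Conclusion: VERBATIM the field type of
`BookingLeaves.htr` (`C = 4c_δ/r`, `ρ i = ψ·α i`).  This is the form the schedule (S1-win) and the uniform-constants cell (S3/S3b)
consume.

HONEST FRAMING.  Rung (B)+1 bookkeeping on ONE finite four-torus of fixed physical size — NOT infinite volume, NOT a mass gap, NOT
OS on ℝ⁴, NOT the Clay problem, NOT summit progress.  NE1′ is NOT PRINTED and NOT PROVED; headline «L-T ⇐ F-1, F-2 (+ H2
dictionary), F-3, F-5, F-6 (incl. `hlink`), F-7, F-8, F-9», never «NE1′ proved»; 0 binders are instantiated on Bałaban's densities;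
no `def`, no `def … : Prop`; nothing of [Balaban1989LargeFieldII] is asserted.  [folklore] kernel glue, 0 sorry, 0 citations
used as hypothesis-free facts.  Spine PROVED 0∕9 unchanged.  HONEST DEPENDENCY: continuum YM on T⁴ ⇐ BetaPertH ∧ nine spine
estimates (0/9 proved); BetaPertH ⇐ (D1) ∧ (D4) ∧ CAP+tail; G-an2-4 gates asym, D1 and NE2/3/4.
-/

noncomputable section

namespace Summit.QuantumFields.BalabanUV.T4Continuum.NE1p.DressedTransportAssembledFinalForm

open MeasureTheory Set Metric Filter Finset
open scoped BigOperators
open Literature.MathematicalPhysics.QuantumFieldTheory.Balaban1983to89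
open Literature.MathematicalPhysics.QuantumFieldTheory.Balaban1983to89.T4TermFormat
open Literature.MathematicalPhysics.QuantumFieldTheory.Balaban1983to89.T4TermFormat.Booking
open Literature.MathematicalPhysics.QuantumFieldTheory.Balaban1983to89.T4GatedBooking
open Literature.MathematicalPhysics.QuantumFieldTheory.Balaban1983to89.T4TrajectoryComparison
open Literature.MathematicalPhysics.QuantumFieldTheory.Balaban1983to89.T4TrajectoryModulus
open Summit.QuantumFields.BalabanUV.T4Continuum.T4TrajectoryDensityDressed
open Summit.QuantumFields.BalabanUV.T4Continuum.NE1p.DressedRoot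
open Summit.QuantumFields.BalabanUV.T4Continuum.NE1p.DressedTransportAssembledData
open Summit.QuantumFields.BalabanUV.T4Continuum.NE1p.DressedTransportAssembledRatio
open T4BirthChartTransport (GaugeInvariant BirthSlice RelGauge)
open T4BlockTransport (Fld NDir latMove latN latMove_zero)
open T4TrajectoryDensity

section FunctionLevel

variable {B : T4TermFormat.Booking} {T : Trajectory B}
variable {R : Type*} [NormedRing R] [NormedAlgebra ℂ R] [MeasurableSpace R] {d : ℕ}

/-- **THE ASSEMBLED TRANSPORT LEAF, INSTANTIATION-FACING FORM** [bookkeeping]: END-F′-RATIO over the canonical data — no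
bookkeeping equalities, no radius floor, no source-vs-floor scalar.  Displayed: the wall binders of END-F, the H2 dictionary
`hQ`/`hSg`, the schedule inequalities `hϱ_birth`/`hϱ_succ` and margins `hmargin` (over `rsOf r ϱ`), the (I4′) link `hlink` (over
`rsOf r ϱ`), positivity (`0 ≤ m` included).  Proof: `hrs_dec` from the schedule inequalities (`rsOf_birth`/`rsOf_succ`), then
`transportLeaf_assembled_ratio` BY NAME with the five equations of `DressedTransportAssembledData`.  Conclusion: EXACTLY the
field `htr` of `BookingLeaves`.  Nothing of Bałaban's densities is asserted. [folklore] -/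
theorem transportLeaf_assembled_canonical_ratio {Fn : B.Birth → ℕ → ℕ → Fld d R → ℂ}
    {rel : B.Birth → ℕ → ℕ → Fld d R → Fld d R → Prop} {𝒦 : B.Birth → ℕ → ℕ → Set (Fld d R)}
    {ref : B.Birth → ℕ → Fld d R → Fld d R} {base : B.Birth → ℕ → Fld d R → ℝ}
    {𝒜 𝒬 : B.Birth → ℕ → Fld d R → Fld d R → ℂ} {q : B.Birth → ℕ → Fld d R → ℂ}
    {μ : B.Birth → ℕ → Measure (Fld d R)} {z₀ z₁ : B.Birth → ℕ → Fld d R} {D : B.Birth → ℕ → Set (Fld d R)}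
    {defect : B.Birth → ℕ → ℕ → ℝ} {cδ ψ w r m : ℝ} {s θ ϱ₁ : B.Birth → ℕ → ℝ} {α : ℕ → ℝ}
    {ϱ : B.Birth → ℕ → ℕ → ℝ} {S : ℕ → B.Birth → Finset B.Birth}
    {Sg : ℕ → B.Birth → Finset (B.Birth × ℕ)} {c : B.Birth → ℕ → ℂ} {δf : B.Birth → ℕ → B.Birth × ℕ → ℝ}
    (hα : ∀ i, 0 ≤ α i) (hr : 0 < r) (hw : 0 < w) (hcδ : 0 ≤ cδ) (hψ : 0 ≤ ψ) (hm : 0 ≤ m)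
    (hsl : ∀ (b : B.Birth) (k' : ℕ), B.birthScale b ≤ k' → k' ≤ B.K →
      RanBelow (budgetGate T s m S (4 * cδ / r) (fun i => ψ * α i)) k' →
      BirthSlice (Fn b k' k') latMove latN (𝒦 b k' k') w r (T.gen b k'))
    (hFn : ∀ (b : B.Birth) (k' k : ℕ), B.birthScale b ≤ k' → k' ≤ k → k + 1 ≤ B.K →
      RanBelow (budgetGate T s m S (4 * cδ / r) (fun i => ψ * α i)) (k + 1) →
      ∀ U, Fn b k' (k + 1) U =
        wOp (expWeight (base b k) (𝒜 b k + 𝒬 b k)) (μ b k) (z₀ b k) U (fun z => Fn b k' k (U + z)))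
    (h𝒢 : ∀ (b : B.Birth) (k' k : ℕ), B.birthScale b ≤ k' → k' ≤ k → k + 1 ≤ B.K →
      RanBelow (budgetGate T s m S (4 * cδ / r) (fun i => ψ * α i)) (k + 1) →
      ∀ U, (fun z => Fn b k' k (U + z)) ∈ BddClass ℂ (μ b k))
    (hD : ∀ b k, (D b k).Nonempty) (hϱ : ∀ b k' k, 0 < ϱ b k' k)
    (hB : ∀ (b : B.Birth) (k' k : ℕ), B.birthScale b ≤ k' → k' ≤ k → k + 1 ≤ B.K →
      RanBelow (budgetGate T s m S (4 * cδ / r) (fun i => ψ * α i)) (k + 1) →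
      RealBaseAt (ref b k) (base b k) (𝒜 b k) (μ b k) (𝒦 b k' (k + 1)))
    (hE : ∀ (b : B.Birth) (k' k : ℕ), B.birthScale b ≤ k' → k' ≤ k → k + 1 ≤ B.K →
      RanBelow (budgetGate T s m S (4 * cδ / r) (fun i => ψ * α i)) (k + 1) →
      ExponentSliceAt (ref b k) (𝒜 b k) (μ b k) latMove latN (𝒦 b k' (k + 1)) w (ϱ b k' k) (s b k))
    (hQ : ∀ b k, (fun U z => 𝒬 b k U z - q b k U) =
      fun U z => c b k * ∑ p ∈ Sg k b, (Fn p.1 p.2 k (U + z) - Fn p.1 p.2 k (U + z₁ b k)))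
    (hSg : ∀ k b, ∀ p ∈ Sg k b, p.1 ∈ S k b ∧ B.birthScale p.1 ≤ p.2 ∧ p.2 ≤ k)
    (hϱ_birth : ∀ (f : B.Birth) (k'' : ℕ), B.birthScale f ≤ k'' → ϱ f k'' k'' < r)
    (hϱ_succ : ∀ (f : B.Birth) (k'' k : ℕ), B.birthScale f ≤ k'' → k'' ≤ k → ϱ f k'' (k + 1) < ϱ f k'' k)
    (hmargin : ∀ (b : B.Birth) (k' k : ℕ), B.birthScale b ≤ k' → k' ≤ k →
      ϱ b k' k < ϱ₁ b k ∧ 0 < ϱ₁ b k ∧ ∀ p ∈ Sg k b, ϱ₁ b k ≤ rsOf r ϱ p.1 p.2 k)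
    -- THE BOOKED LINK over the canonical radius: transverse fresh defect RELATIVE TO THE CURRENT CHART RADIUS at the transport rate
    (hlink : ∀ b k, ∀ p ∈ Sg k b,
      0 ≤ δf b k p ∧ ‖c b k‖ * (δf b k p / rsOf r ϱ p.1 p.2 k) ≤ m * (cδ / r) * ψ ^ (k - p.2))
    (hδfw : ∀ b k, ∀ p ∈ Sg k b, δf b k p ≤ w)
    (hDμ : ∀ b k, ∀ᵐ z ∂μ b k, z ∈ D b k)
    (hN1 : ∀ (b : B.Birth) (k' k : ℕ), B.birthScale b ≤ k' → k' ≤ k → k + 1 ≤ B.K →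
      ∀ z ∈ D b k, ∀ U ∈ 𝒦 b k' (k + 1), U + z ∈ 𝒦 b k' k)
    (hN2 : ∀ (b : B.Birth) (k' k : ℕ), B.birthScale b ≤ k' → k' ≤ k → k + 1 ≤ B.K →
      ∀ U₀ ∈ 𝒦 b k' (k + 1), ∀ p : NDir d R, latN p ≤ w → ∀ z' ∈ D b k, latMove U₀ p 1 + z' ∈ 𝒦 b k' k)
    (hN1x : ∀ (b : B.Birth) (k' k : ℕ), B.birthScale b ≤ k' → k' ≤ k →
      ∀ p ∈ Sg k b, ∀ z ∈ D b k, ∀ U ∈ 𝒦 b k' (k + 1), U + z ∈ 𝒦 p.1 p.2 k)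
    (hN2cx : ∀ (b : B.Birth) (k' k : ℕ), B.birthScale b ≤ k' → k' ≤ k →
      ∀ p ∈ Sg k b, ∀ U₀ ∈ 𝒦 b k' (k + 1), ∀ pd : NDir d R, 0 < latN pd → latN pd ≤ w →
        ∀ t ∈ tube (ϱ₁ b k / latN pd), latMove U₀ pd t + z₁ b k ∈ 𝒦 p.1 p.2 k)
    (hpairx : ∀ (b : B.Birth) (k' k : ℕ), B.birthScale b ≤ k' → k' ≤ k →
      ∀ p ∈ Sg k b, ∀ U₀ ∈ 𝒦 b k' (k + 1), ∀ pd : NDir d R, 0 < latN pd → latN pd ≤ w →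
        ∀ᵐ z ∂μ b k, ∀ t ∈ tube (ϱ₁ b k / latN pd),
          RelGauge (rel p.1 p.2 k) latMove latN (latMove U₀ pd t + z₁ b k) (latMove U₀ pd t + z) (δf b k p))
    (hdiam : ∀ b k, ∀ z ∈ D b k, ∀ z' ∈ D b k, ∀ x ν, ‖z x ν - z' x ν‖ ≤ θ b k)
    (hθ : ∀ b k, 0 < θ b k ∧ θ b k ≤ w)
    (hdom : ∀ (b : B.Birth) (k' k : ℕ), B.birthScale b ≤ k' → k' ≤ k → k + 1 ≤ B.K →
      Real.exp 3 * (1 + 4 * θ b k / ϱ b k' k) ≤ α k)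
    (hinv : ∀ b k' k, GaugeInvariant (rel b k' k) (Fn b k' k))
    (hmeas : ∀ (b f : B.Birth) (k'' k : ℕ) (U : Fld d R), AEStronglyMeasurable (fun z => Fn f k'' k (U + z)) (μ b k))
    (hdefw : ∀ b k' k, defect b k' k ≤ w)
    (hrate : ∀ (b : B.Birth) (k' k : ℕ), B.birthScale b ≤ k' → k' ≤ k → k ≤ B.K →
      defect b k' k ≤ cδ * ψ ^ (k - k'))
    (hlin : ∀ (b : B.Birth) (k' k : ℕ), B.birthScale b ≤ k' → k' ≤ k → k ≤ B.K →
      RanBelow (budgetGate T s m S (4 * cδ / r) (fun i => ψ * α i)) k → ∀ ε > 0,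
      ∃ U₀ ∈ 𝒦 b k' k, ∃ U₁ : Fld d R, RelGauge (rel b k' k) latMove latN U₀ U₁ (defect b k' k) ∧
        T.lin b k' k ≤ ‖Fn b k' k U₁ - Fn b k' k U₀‖ + ε) :
    T.TransportsFromVar (4 * cδ / r) (fun i => ψ * α i) (budgetGate T s m S (4 * cδ / r) (fun i => ψ * α i)) := by
  -- the schedule inequalities give the radius decrease for the canonical radius
  have hrs_dec : ∀ (f : B.Birth) (k'' k : ℕ), B.birthScale f ≤ k'' → k'' ≤ k → ϱ f k'' k < rsOf r ϱ f k'' k := by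
    intro f k'' k hf hk''
    rcases Nat.lt_or_eq_of_le hk'' with hlt | heq
    · obtain ⟨k₀, rfl⟩ : ∃ k₀, k = k₀ + 1 := ⟨k - 1, by omega⟩
      have hk₀ : k'' ≤ k₀ := Nat.lt_succ_iff.mp hlt
      rw [rsOf_succ r ϱ f hk₀]
      exact hϱ_succ f k'' k₀ hf hk₀
    · subst heq
      rw [rsOf_birth]
      exact hϱ_birth f k'' hf
  exact transportLeaf_assembled_ratio (rs := rsOf r ϱ) (Asz := aszOf T.gen s c Sg δf (rsOf r ϱ))
    (s1 := s1Of T.gen s c Sg δf (rsOf r ϱ)) hα hr hw hcδ hψ hm hsl hFn h𝒢 hD hϱ hB hE hQ hSg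
    (s1Of_eq T.gen s c Sg δf (rsOf r ϱ)) (aszOf_birth T.gen s c Sg δf (rsOf r ϱ)) (rsOf_birth r ϱ)
    (fun f k'' k _ hk => aszOf_succ T.gen s c Sg δf (rsOf r ϱ) f hk) (fun f k'' k _ hk => rsOf_succ r ϱ f hk)
    hrs_dec hmargin hlink hδfw hDμ hN1 hN2 hN1x hN2cx hpairx hdiam hθ hdom hinv hmeas hdefw hrate hlin

end FunctionLevel

end Summit.QuantumFields.BalabanUV.T4Continuum.NE1p.DressedTransportAssembledFinalForm

end
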